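import Mathlib
import Literature.AlgebraicGeometry.ShimuraVarieties.UnitaryBallChartFormula
import Literature.AlgebraicGeometry.ShimuraVarieties.UnitaryBallPeterssonDescent
import Literature.NumberTheory.Transcendental.FormsAlgebraWedgeProofs
import Literature.AlgebraicGeometry.HodgeTheory.HypersurfaceHolomorphicForms
import Literature.Geometry.Kaehler.TwoFormRealPairing
import HarnessLib

/-!
# The uniformisation change of variables `∫_{𝓕} conj(F_{α′}) F_α dv = c ∫_X α ∧ ᾱ′` (kernel)

KERNEL DISCHARGE of the junction hypothesis `UnitaryBallUniformisationDatum.BallWedgeFormula`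
(`Literature/AlgebraicGeometry/ShimuraVarieties/UnitaryBallPeterssonRecord.lean`, registry node
N-D2 / D2-chart of the pub-hodgecm model construction): for a unitary ball-quotient datum
`D : UnitaryBallUniformisationDatum 2 X₂`, a Hodge model `A` (real model space of dimension `4`), a
Sylvester frame `𝔣` and a continuous orientation family `o` of `X₂^an`, there is ONE constant
`c ≠ 0` such that for every measurable fundamental domain `𝓕 ⊆ 𝔹²` of `Δ = ρ_𝔣(Γ)` for the
Lebesgue measure and all holomorphic `2`-forms `α, α′` on `X₂^an`,

  `∫_{z ∈ 𝓕} conj (F_{α′}(z)) F_α(z) dv = c · ∫_{(X₂^an, o)} α ∧ ᾱ′`     (`ballWedgeFormula`),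

`F_α = ψ^* α` (`D.holFormPullback₂ A 𝔣 ⊤ α`). Explicitly `c = (4 ε κ)⁻¹` with `ε = ±1` the
orientation sign of `ψ` and `κ > 0` the Haar factor of `UnitaryBallChartFormula`.

Proof. (1) **The `(2,2)` shuffle formula for complex-valued forms**
(`ContinuousAlternatingMap.wedge_apply_two_two_complex`; Warner (1983), 2.10(b)) — the six
`(2,2)`-shuffles, exactly as the real-valued `Literature.Geometry.Symplectic.wedge_apply_two_two`.
(2) **The pointwise identity** (`wedge_conj_apply_unifDeriv_ballBasis`): a holomorphic `2`-form is
`ℂ`-bilinear at every point (`IsHolomorphicInCharts.exists_apply_eq_restrictScalars`; the pair rules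
`apply_pair_I_smul_left/right`, `apply_pair_self_complex` of `Kaehler.TwoFormRealPairing`) and `dψ` is
`ℂ`-linear (`unifDeriv_smul`), so with `u = dψ_z e₀`, `v = dψ_z e₁` and the real frame
`(e₀, i e₀, e₁, i e₁)` of `ℂ²` (`ballBasis`),
`(α ∧ ᾱ′)_{ψ z}(u, iu, v, iv) = 4 F_α(z) conj F_{α′}(z)` (the terms `α(u, iu) = i α(u, u) = 0`
drop, the four surviving shuffles each contribute `F_α conj F_{α′}`). (3) **Assembly**: the chart
formula `UnitaryBallUniformisationDatum.integrableOn_topDensity_and_integral_eq` applied to the real and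
imaginary parts of the smooth top form `α ∧ ᾱ′` (`IsSmoothFormWedge_holds`, `isSmoothForm_conj`),
whose ball densities are `Re` / `Im` of the continuous function `4 F_α conj F_{α′}`
(`continuous_holFormPullback₂`), and `∫ G = ∫ Re G + i ∫ Im G` (`setIntegral_re_add_im`);
compactness of `X₂^an` is `HodgeModel.compactSpace_carrier`. **Corollary**
(`peterssonWedgeFormula_of_baily`): `BallForms.Baily1973_10_3 μ → D.PeterssonWedgeFormula A 𝔣 o μ`
(autform-1's `PeterssonWedgeFormula_of` with its `BallWedgeFormula` input discharged).

Everything here is proved in the kernel; no definitions, no records, no named facts.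

## References

* F. W. Warner, *Foundations of Differentiable Manifolds and Lie Groups*, Springer GTM 94 (1983),
  2.10(b), 4.8. [Warner1983]
* C. Voisin, *Hodge Theory and Complex Algebraic Geometry I* (2002), §2.2.1, §6.3.2.
  [VoisinHodgeI2002]
* A. Borel, *Introduction to the cohomology of arithmetic groups* (1997), §5.14. [Borel1997]

Written under the LEAN-IN-TREE rule for the pub-hodgecm formalisation cell (model-construction
sub-cell, seat mc-unitary-3 gen 2, node D2-chart). Everything here is kernel-checked; nothing is a
claim of the manuscripts adjudicated by that cell.
-/

set_option autoImplicit false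

noncomputable section

open Matrix MulAction Function Set Filter Complex Module MeasureTheory
open scoped Manifold Topology NNReal Pointwise ENNReal ComplexConjugate
open Literature.Geometry.ComplexHyperbolic
open Literature.Geometry.ComplexHyperbolic.BallModel (U21 Ball Jac nsq actVec ballVolume)
open Literature.NumberTheory.Transcendental
open Literature.AlgebraicGeometry.HodgeTheory (HodgeModel)
open Literature.AlgebraicGeometry.Motives (cintegral)
open Literature.Geometry.Kaehler (MForm IsSmoothForm IsHolomorphicInCharts holFormsInCharts
  isHolomorphicInCharts_of_mem isSmoothForm_of_mem apply_pair_I_smul_left apply_pair_I_smul_right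
  apply_pair_self_complex)
open Literature.Analysis.Complex

/-! ### (1) The `(2,2)` shuffle formula for complex-valued forms -/

namespace ContinuousAlternatingMap

variable {V : Type*} [NormedAddCommGroup V] [NormedSpace ℝ V]

/-- The inner alternating sum of the `(2,2)` shuffle formula, complex coefficients (one vector of
`β` frozen): `∑_{e ∈ 𝔖₃} sign e · β(x, w_{e0}) γ(w_{e1}, w_{e2})`
`= 2 (β(x,w₀)γ(w₁,w₂) - β(x,w₁)γ(w₀,w₂) + β(x,w₂)γ(w₀,w₁))`. [folklore] -/
theorem sum_perm_three_sign_smul_apply_complex (β γ : V [⋀^Fin 2]→L[ℝ] ℂ) (x : V) (p q r : V) :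
    ∑ e : Equiv.Perm (Fin (2 + 1)), (Equiv.Perm.sign e : ℤ) •
        (β ![x, ((![p, q, r] : Fin (2 + 1) → V) ∘ e) 0] *
          γ ![((![p, q, r] : Fin (2 + 1) → V) ∘ e) 1, ((![p, q, r] : Fin (2 + 1) → V) ∘ e) 2]) =
      2 * (β ![x, p] * γ ![q, r] - β ![x, q] * γ ![p, r] + β ![x, r] * γ ![p, q]) := by
  have hfin2 : ∀ f : Equiv.Perm (Fin 2) → ℂ,
      ∑ e : Equiv.Perm (Fin 2), (Equiv.Perm.sign e : ℤ) • f e = f 1 - f (Equiv.swap 0 1) := by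
    intro f
    have huniv : (Finset.univ : Finset (Equiv.Perm (Fin 2))) = {1, Equiv.swap 0 1} := by decide
    rw [huniv, Finset.sum_pair (by decide), Equiv.Perm.sign_one, Equiv.Perm.sign_swap (by decide)]
    simp [sub_eq_add_neg]
  have r03 : ∀ a b c : V, (0 : Fin 3).removeNth (![a, b, c] : Fin 3 → V) = ![b, c] :=
    fun a b c ↦ by funext i; fin_cases i <;> rfl
  have r13 : ∀ a b c : V, (1 : Fin 3).removeNth (![a, b, c] : Fin 3 → V) = ![a, c] :=
    fun a b c ↦ by funext i; fin_cases i <;> rfl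
  have r23 : ∀ a b c : V, (2 : Fin 3).removeNth (![a, b, c] : Fin 3 → V) = ![a, b] :=
    fun a b c ↦ by funext i; fin_cases i <;> rfl
  set g : (Fin (2 + 1) → V) → ℂ := fun z ↦ β ![x, z 0] * γ ![z 1, z 2] with hg
  have h1 : ∑ e : Equiv.Perm (Fin (2 + 1)), (Equiv.Perm.sign e : ℤ) •
      (β ![x, ((![p, q, r] : Fin (2 + 1) → V) ∘ e) 0] *
        γ ![((![p, q, r] : Fin (2 + 1) → V) ∘ e) 1, ((![p, q, r] : Fin (2 + 1) → V) ∘ e) 2]) =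
      ∑ e : Equiv.Perm (Fin (2 + 1)), (Equiv.Perm.sign e : ℤ) • g (![p, q, r] ∘ e) := rfl
  rw [h1, sum_perm_sign_smul_comp_eq_sum_cons, Fin.sum_univ_three]
  simp only [hfin2, hg, Fin.cons_zero]
  have hsw2 : ∀ p q : V, ((![p, q] : Fin 2 → V) ∘ (Equiv.swap (0 : Fin 2) 1)) = ![q, p] :=
    fun p q ↦ by funext i; fin_cases i <;> rfl
  have hid2 : ∀ p q : V, ((![p, q] : Fin 2 → V) ∘ (1 : Equiv.Perm (Fin 2))) = ![p, q] :=
    fun p q ↦ by funext i; rfl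
  have hc1 : ∀ x p q : V, (Fin.cons x (![p, q] : Fin 2 → V) : Fin 3 → V) 1 = p := fun x p q ↦ rfl
  have hc2 : ∀ x p q : V, (Fin.cons x (![p, q] : Fin 2 → V) : Fin 3 → V) 2 = q := fun x p q ↦ rfl
  have hv0 : (![p, q, r] : Fin 3 → V) 0 = p := rfl
  have hv1 : (![p, q, r] : Fin 3 → V) 1 = q := rfl
  have hv2 : (![p, q, r] : Fin 3 → V) 2 = r := rfl
  simp only [r03, r13, r23, hsw2, hid2, hc1, hc2, hv0, hv1, hv2]
  have hsw : ∀ p q : V, γ ![q, p] = -γ ![p, q] := fun p q ↦ by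
    have h := γ.map_swap ![p, q] (i := 0) (j := 1) (by decide)
    rw [hsw2] at h
    exact h
  rw [hsw q r, hsw p r, hsw p q]
  simp only [Fin.val_zero, Fin.val_one, Fin.val_two, pow_zero, pow_one, one_smul, neg_smul,
    even_two.neg_pow, one_pow]
  ring

/-- **The wedge of two complex-valued `2`-forms on four vectors** (the six `(2,2)`-shuffles;
Warner (1983), 2.10(b), `k = l = 2`):
`(β ∧ γ)(a, b, c, d) = β(a,b)γ(c,d) - β(a,c)γ(b,d) + β(a,d)γ(b,c)`
`+ β(c,d)γ(a,b) - β(b,d)γ(a,c) + β(b,c)γ(a,d)`. [cite: Warner1983, 2.10(b), formula (2)] -/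
theorem wedge_apply_two_two_complex (β γ : V [⋀^Fin 2]→L[ℝ] ℂ) (a b c d : V) :
    β.wedge γ ![a, b, c, d] =
      β ![a, b] * γ ![c, d] - β ![a, c] * γ ![b, d] + β ![a, d] * γ ![b, c] +
        β ![c, d] * γ ![a, b] - β ![b, d] * γ ![a, c] + β ![b, c] * γ ![a, d] := by
  have r04 : ∀ a b c d : V, (0 : Fin 4).removeNth (![a, b, c, d] : Fin 4 → V) = ![b, c, d] :=
    fun a b c d ↦ by funext i; fin_cases i <;> rfl
  have r14 : ∀ a b c d : V, (1 : Fin 4).removeNth (![a, b, c, d] : Fin 4 → V) = ![a, c, d] :=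
    fun a b c d ↦ by funext i; fin_cases i <;> rfl
  have r24 : ∀ a b c d : V, (2 : Fin 4).removeNth (![a, b, c, d] : Fin 4 → V) = ![a, b, d] :=
    fun a b c d ↦ by funext i; fin_cases i <;> rfl
  have r34 : ∀ a b c d : V, (3 : Fin 4).removeNth (![a, b, c, d] : Fin 4 → V) = ![a, b, c] :=
    fun a b c d ↦ by funext i; fin_cases i <;> rfl
  set f : (Fin (3 + 1) → V) → ℂ := fun z ↦ β ![z 0, z 1] * γ ![z 2, z 3] with hf
  have h1 : β.wedge γ ![a, b, c, d] = ((Nat.factorial 2 * Nat.factorial 2 : ℕ) : ℝ)⁻¹ •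
      ∑ σ : Equiv.Perm (Fin (3 + 1)), (Equiv.Perm.sign σ : ℤ) • f (![a, b, c, d] ∘ σ) := by
    rw [wedge_apply_zsmul]
    congr 1
    refine Fintype.sum_equiv (Equiv.refl _) _ _ fun σ ↦ ?_
    simp only [Equiv.refl_apply, hf, Function.comp_apply]
    congr 2
    · congr 1
      funext i; fin_cases i <;> rfl
    · congr 1
      funext j; fin_cases j <;> rfl
  rw [h1, sum_perm_sign_smul_comp_eq_sum_cons, Fin.sum_univ_four]
  have hc1 : ∀ (x : V) (w : Fin 3 → V), (Fin.cons x w : Fin 4 → V) 1 = w 0 := fun x w ↦ rfl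
  have hc2 : ∀ (x : V) (w : Fin 3 → V), (Fin.cons x w : Fin 4 → V) 2 = w 1 := fun x w ↦ rfl
  have hc3 : ∀ (x : V) (w : Fin 3 → V), (Fin.cons x w : Fin 4 → V) 3 = w 2 := fun x w ↦ rfl
  have hv0 : (![a, b, c, d] : Fin 4 → V) 0 = a := rfl
  have hv1 : (![a, b, c, d] : Fin 4 → V) 1 = b := rfl
  have hv2 : (![a, b, c, d] : Fin 4 → V) 2 = c := rfl
  have hv3 : (![a, b, c, d] : Fin 4 → V) 3 = d := rfl
  simp only [hf, Fin.cons_zero, hc1, hc2, hc3, hv0, hv1, hv2, hv3, r04, r14, r24, r34,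
    sum_perm_three_sign_smul_apply_complex]
  have hsw2 : ∀ p q : V, ((![p, q] : Fin 2 → V) ∘ (Equiv.swap (0 : Fin 2) 1)) = ![q, p] :=
    fun p q ↦ by funext i; fin_cases i <;> rfl
  have hswβ : ∀ p q : V, β ![q, p] = -β ![p, q] := fun p q ↦ by
    have h := β.map_swap ![p, q] (i := 0) (j := 1) (by decide)
    rw [hsw2] at h
    exact h
  rw [hswβ a b, hswβ a c, hswβ b c, hswβ a d, hswβ b d, hswβ c d]
  have h3 : ((3 : Fin (3 + 1)) : ℕ) = 3 := rfl
  simp only [Fin.val_zero, Fin.val_one, Fin.val_two, h3, pow_zero, one_smul,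
    even_two.neg_pow, one_pow, Nat.factorial_two, Complex.real_smul, zsmul_eq_mul, Int.cast_pow,
    Int.cast_neg, Int.cast_one]
  push_cast
  ring

end ContinuousAlternatingMap

namespace Literature.AlgebraicGeometry.ShimuraVarieties

open BallUnfolding

/-! ### (2) The pointwise identity `(α ∧ ᾱ′)_{ψ z}(dψ b) = 4 F_α conj F_{α′}` -/

namespace UnitaryBallUniformisationDatum

variable {X₂ : Motives.SchemeOver ℂ} (D : UnitaryBallUniformisationDatum 2 X₂) (A : HodgeModel 2 X₂)
  (𝔣 : D.SylvesterFrame)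

/-- `i e_j = i • e_j` in `ℂ²`. [folklore] -/
theorem single_I_eq_smul (j : Fin 2) :
    (Pi.single j Complex.I : Fin 2 → ℂ) = Complex.I • (Pi.single j 1 : Fin 2 → ℂ) := by
  rw [← Pi.single_smul', smul_eq_mul, mul_one]

/-- **The pointwise identity.** For holomorphic `2`-forms `α, α′` on `X₂^an` and `z ∈ 𝔹²`, the
top form `α ∧ ᾱ′` at `ψ z` evaluated on the frame `(dψ_z e₀, dψ_z (i e₀), dψ_z e₁, dψ_z (i e₁))` is
`4 F_α(z) conj (F_{α′}(z))`, `F_α(z) = α_{ψ z}(dψ_z e₀, dψ_z e₁)` (`formPullback₂`): a holomorphic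
form is `ℂ`-bilinear at each point and `dψ_z` is `ℂ`-linear. [cite: VoisinHodgeI2002, §6.3.2] -/
theorem wedge_conj_apply_unifDeriv_ballBasis (α α' : holFormsInCharts A.model A.carrier 2)
    (z : Ball) :
    ((α : MForm 𝓘(ℝ, A.model) A.carrier ℂ 2).wedge
        (α' : MForm 𝓘(ℝ, A.model) A.carrier ℂ 2).conj) (D.modelUnif A 𝔣 z.1)
        (fun k ↦ D.unifDeriv A 𝔣 z.1 (ballBasis k)) =
      4 * (D.formPullback₂ A 𝔣 α.1 z * conj (D.formPullback₂ A 𝔣 α'.1 z)) := by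
  obtain ⟨a, ha⟩ :=
    (isHolomorphicInCharts_of_mem α).exists_apply_eq_restrictScalars (D.modelUnif A 𝔣 z.1)
  obtain ⟨a', ha'⟩ :=
    (isHolomorphicInCharts_of_mem α').exists_apply_eq_restrictScalars (D.modelUnif A 𝔣 z.1)
  -- the pulled-back functions are values of the `ℂ`-bilinear forms `a`, `a'`
  have hF : D.formPullback₂ A 𝔣 α.1 z =
      a ![D.unifDeriv A 𝔣 z.1 (Pi.single 0 1), D.unifDeriv A 𝔣 z.1 (Pi.single 1 1)] := by
    rw [formPullback₂_apply, ha]; rfl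
  have hF' : D.formPullback₂ A 𝔣 α'.1 z =
      a' ![D.unifDeriv A 𝔣 z.1 (Pi.single 0 1), D.unifDeriv A 𝔣 z.1 (Pi.single 1 1)] := by
    rw [formPullback₂_apply, ha']; rfl
  rw [hF, hF']
  set u : A.model := D.unifDeriv A 𝔣 z.1 (Pi.single 0 1) with hu
  set v : A.model := D.unifDeriv A 𝔣 z.1 (Pi.single 1 1) with hv
  -- the frame `dψ_z (e₀, i e₀, e₁, i e₁) = (u, i u, v, i v)`
  have h0 : D.unifDeriv A 𝔣 z.1 (ballBasis 0) = u := by rw [ballBasis_zero]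
  have h1 : D.unifDeriv A 𝔣 z.1 (ballBasis 1) = Complex.I • u := by
    rw [ballBasis_one, single_I_eq_smul, D.unifDeriv_smul A 𝔣 z]
  have h2 : D.unifDeriv A 𝔣 z.1 (ballBasis 2) = v := by rw [ballBasis_two]
  have h3 : D.unifDeriv A 𝔣 z.1 (ballBasis 3) = Complex.I • v := by
    rw [ballBasis_three, single_I_eq_smul, D.unifDeriv_smul A 𝔣 z]
  have hvec : (fun k ↦ D.unifDeriv A 𝔣 z.1 (ballBasis k)) =
      (![u, Complex.I • u, v, Complex.I • v] : Fin 4 → A.model) := by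
    funext k
    fin_cases k
    · exact h0
    · exact h1
    · exact h2
    · exact h3
  -- the top form at `ψ z`, as a wedge of forms on the model space
  have hWx : ((α : MForm 𝓘(ℝ, A.model) A.carrier ℂ 2).wedge
      (α' : MForm 𝓘(ℝ, A.model) A.carrier ℂ 2).conj) (D.modelUnif A 𝔣 z.1) =
      (letI b : A.model [⋀^Fin 2]→L[ℝ] ℂ := a.restrictScalars ℝ
       letI b' : A.model [⋀^Fin 2]→L[ℝ] ℂ :=
         (Complex.conjCLE : ℂ →L[ℝ] ℂ).compContinuousAlternatingMap (a'.restrictScalars ℝ)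
       (b.wedge b' : A.model [⋀^Fin (2 + 2)]→L[ℝ] ℂ)) := by
    rw [MForm.wedge_apply]
    simp only [MForm.conj]
    rw [ha, ha']
    rfl
  rw [hvec, hWx]
  -- the `(2,2)` shuffle formula (unified up to the tangent-space synonyms)
  refine (ContinuousAlternatingMap.wedge_apply_two_two_complex _ _ _ _ _ _).trans ?_
  simp only [ContinuousAlternatingMap.coe_restrictScalars,
    ContinuousLinearMap.compContinuousAlternatingMap_coe, Function.comp_apply,
    ContinuousLinearEquiv.coe_coe, Complex.conjCLE_apply, apply_pair_I_smul_left,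
    apply_pair_I_smul_right, apply_pair_self_complex, map_mul, Complex.conj_I, mul_zero, map_zero]
  linear_combination (-4 * a ![u, v] * conj (a' ![u, v])) * Complex.I_sq

/-- The density `z ↦ 4 F_α(z) conj F_{α′}(z)` is continuous on the ball. [folklore] -/
theorem continuous_wedgeDensity (α α' : holFormsInCharts A.model A.carrier 2) :
    Continuous fun z : Ball ↦
      4 * (D.formPullback₂ A 𝔣 α.1 z * conj (D.formPullback₂ A 𝔣 α'.1 z)) := by
  have hF : Continuous fun z : Ball ↦ D.formPullback₂ A 𝔣 α.1 z :=
    D.continuous_holFormPullback₂ A 𝔣 α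
  have hF' : Continuous fun z : Ball ↦ D.formPullback₂ A 𝔣 α'.1 z :=
    D.continuous_holFormPullback₂ A 𝔣 α'
  exact continuous_const.mul (hF.mul (Complex.continuous_conj.comp hF'))

/-! ### (3) The discharge of `BallWedgeFormula` -/

variable [MeasurableSpace A.model] [BorelSpace A.model] [Fact (finrank ℝ A.model = 4)]

/-- **The uniformisation change of variables** (KERNEL discharge of the junction hypothesis
`BallWedgeFormula`): for a continuous orientation family `o` there is `c ≠ 0` (namely
`c = (4 ε κ)⁻¹`) with `∫_{𝓕} conj (F_{α′}) F_α dv = c ∫_{(X₂^an, o)} α ∧ ᾱ′` for every measurable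
fundamental domain `𝓕 ⊆ 𝔹²` of `ρ_𝔣(Γ)` and all holomorphic `2`-forms `α, α′`.
[cite: VoisinHodgeI2002, §6.3.2] [cite: Warner1983, 4.8] -/
theorem ballWedgeFormula
    (o : (x : A.carrier) → Orientation ℝ (TangentSpace 𝓘(ℝ, A.model) x) (Fin 4)) :
    D.BallWedgeFormula A 𝔣 o := by
  intro ho
  haveI : CompactSpace A.carrier := HodgeModel.compactSpace_carrier A D.isSmoothProjective
  set ε : ℝ := D.orientSign A 𝔣 o BallModel.x₀ with hεdef
  set κ : ℝ := (ballHaarFactor : ℝ) with hκdef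
  have hε : ε ≠ 0 := D.orientSign_center_ne_zero A 𝔣 o ho
  have hκ : κ ≠ 0 := (NNReal.coe_pos.2 ballHaarFactor_pos).ne'
  have hε' : (ε : ℂ) ≠ 0 := Complex.ofReal_ne_zero.2 hε
  have hκ' : (κ : ℂ) ≠ 0 := Complex.ofReal_ne_zero.2 hκ
  refine ⟨(4 * ((ε : ℂ) * (κ : ℂ)))⁻¹, inv_ne_zero (mul_ne_zero (by norm_num) (mul_ne_zero hε' hκ')),
    fun 𝓕 h𝓕m h𝓕 α α' ↦ ?_⟩
  have hΔ : IsImageOfΓ D 𝔣 (D.ballImage 𝔣) := isImageOfΓ_map_top D 𝔣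
  -- the top form `W = α ∧ ᾱ′` and its density `G = 4 F conj F′`
  set W : MForm 𝓘(ℝ, A.model) A.carrier ℂ 4 :=
    (α : MForm 𝓘(ℝ, A.model) A.carrier ℂ 2).wedge
      (α' : MForm 𝓘(ℝ, A.model) A.carrier ℂ 2).conj with hW
  set G : Ball → ℂ := fun z ↦
    4 * (D.formPullback₂ A 𝔣 α.1 z * conj (D.formPullback₂ A 𝔣 α'.1 z)) with hG
  have hWs : IsSmoothForm W :=
    IsSmoothFormWedge_holds (I := 𝓘(ℝ, A.model)) (M := A.carrier) (A := ℂ)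
      (isSmoothForm_of_mem α) (isSmoothForm_conj (isSmoothForm_of_mem α'))
  have hpt : ∀ z : Ball,
      W (D.modelUnif A 𝔣 z.1) (fun k ↦ D.unifDeriv A 𝔣 z.1 (ballBasis k)) = G z :=
    fun z ↦ D.wedge_conj_apply_unifDeriv_ballBasis A 𝔣 α α' z
  have hre : ∀ z : Ball, D.topDensity A 𝔣 W.re z = (G z).re := fun z ↦ by
    rw [← hpt z]; rfl
  have him : ∀ z : Ball, D.topDensity A 𝔣 W.im z = (G z).im := fun z ↦ by
    rw [← hpt z]; rfl
  have hGc : Continuous G := D.continuous_wedgeDensity A 𝔣 α α'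
  have hrec : Continuous (D.topDensity A 𝔣 W.re) := by
    rw [show D.topDensity A 𝔣 W.re = fun z ↦ (G z).re from funext hre]
    exact Complex.continuous_re.comp hGc
  have himc : Continuous (D.topDensity A 𝔣 W.im) := by
    rw [show D.topDensity A 𝔣 W.im = fun z ↦ (G z).im from funext him]
    exact Complex.continuous_im.comp hGc
  obtain ⟨hreI, hreE⟩ :=
    D.integrableOn_topDensity_and_integral_eq A 𝔣 o ho hWs.re hrec hΔ h𝓕 h𝓕m
  obtain ⟨himI, himE⟩ :=
    D.integrableOn_topDensity_and_integral_eq A 𝔣 o ho hWs.im himc hΔ h𝓕 h𝓕m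
  -- the real identities, with the density rewritten as `Re G`, `Im G`
  have hreE' : MForm.integral o W.re = ε * κ * ∫ z in 𝓕, (G z).re ∂ballVolume := by
    rw [hreE, setIntegral_congr_fun h𝓕m fun z _ ↦ hre z]
  have himE' : MForm.integral o W.im = ε * κ * ∫ z in 𝓕, (G z).im ∂ballVolume := by
    rw [himE, setIntegral_congr_fun h𝓕m fun z _ ↦ him z]
  -- `G` is integrable on `𝓕` and `∫ G = ∫ Re G + i ∫ Im G`
  have hGint : IntegrableOn G 𝓕 ballVolume := by
    refine (Integrable.re_im_iff (𝕜 := ℂ)).1 ⟨?_, ?_⟩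
    · have h := hreI.congr (Eventually.of_forall hre)
      simpa only [RCLike.re_to_complex] using h
    · have h := himI.congr (Eventually.of_forall him)
      simpa only [RCLike.im_to_complex] using h
  have hsum : ((∫ z in 𝓕, (G z).re ∂ballVolume : ℝ) : ℂ) +
      ((∫ z in 𝓕, (G z).im ∂ballVolume : ℝ) : ℂ) * Complex.I = ∫ z in 𝓕, G z ∂ballVolume := by
    have h := setIntegral_re_add_im (𝕜 := ℂ) hGint
    simpa only [RCLike.re_to_complex, RCLike.im_to_complex, RCLike.I_to_complex,
      Complex.coe_algebraMap] using h
  -- the left-hand side is `4⁻¹ ∫ G`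
  have hL : ∫ z in 𝓕, conj ((D.holFormPullback₂ A 𝔣 ⊤ α' : Ball → ℂ) z) *
      (D.holFormPullback₂ A 𝔣 ⊤ α : Ball → ℂ) z ∂ballVolume =
      (4 : ℂ)⁻¹ * ∫ z in 𝓕, G z ∂ballVolume := by
    rw [← integral_const_mul]
    refine setIntegral_congr_fun h𝓕m fun z _ ↦ ?_
    simp only [coe_holFormPullback₂, hG]
    ring
  rw [hL, Motives.cintegral, hreE', himE', ← hsum]
  push_cast
  field_simp

/-- **Corollary — row N-D2 reduced to Baily's print record alone**: with `BallWedgeFormula` now a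
theorem, autform-1's `PeterssonWedgeFormula_of` gives the Petersson–wedge formula
`∫_{𝓕} liftPairing (F_{α′}) (F_α) dμ = c ∫_X α ∧ ᾱ′` on `U(2,1)` from the PUBLISHED input
`BallForms.Baily1973_10_3 μ` (Baily (1973), Thm 10.3) and nothing else.
[cite: VoisinHodgeI2002, §6.3.2] -/
theorem peterssonWedgeFormula_of_baily [DiscreteTopology (D.ballImage 𝔣)]
    [CompactSpace (U21 ⧸ D.ballImage 𝔣)]
    (o : (x : A.carrier) → Orientation ℝ (TangentSpace 𝓘(ℝ, A.model) x) (Fin 4))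
    (μ : Measure U21) (hB : BallForms.Baily1973_10_3 μ) : D.PeterssonWedgeFormula A 𝔣 o μ :=
  D.PeterssonWedgeFormula_of A 𝔣 o μ hB (D.ballWedgeFormula A 𝔣 o)

end UnitaryBallUniformisationDatum

end Literature.AlgebraicGeometry.ShimuraVarieties
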